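import Summits.MatrixMultiplication.MatrixMultiplication.Theorems.FarEdgeDescentAnchorLaw
import Mathlib.MeasureTheory.Integral.Bochner.Basic
import Mathlib.MeasureTheory.Measure.Dirac
import HarnessLib

/-!
# Route `FarEdgeDescent` — THE LAPLACE LAW: one umbrella over every anchored law `L(a)`, `a ≥ 1`
(lens-2 «special vs generic», gen 42; support module for the crux `AnchoredLogConvexity`
stmt-MatrixMultiplication-28900; def-free; cut of record UNCHANGED)

The generic leaf `AnchoredLogConvexity = L(1)` and its aside `RealLogConvexity` (28902) are the ORDER-TWO
MINORS of one positivity statement.  Say the excess `e(x) = ω(1,x,1) − (x+1)` obeys the **Laplace law** if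
on `[1,∞)` it is the Laplace transform of a finite positive measure `ν` on `[0,∞)` in the variable `x − 1`:
`e(x) = ∫ exp(−u(x−1)) dν(u)` (Bernstein: ⟺ `e` completely monotone on `[1,∞)`).  Then (abstract `g` first,
the excess by specialisation; hypotheses inline, no definitions):

* `hankelForm_nonneg_of_laplace` — EXPONENTIAL CONVEXITY: every Hankel form `∑ᵢⱼ cᵢcⱼ g(xᵢ+xⱼ−1)`,
  `xᵢ ≥ 1`, is `≥ 0` (it is `∫ (∑ᵢ cᵢ e^{−u(xᵢ−1)})² dν`). [cite: Widder1941, Ch. IV Thm. 21; Ch. IV §12]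
* `logConvexShape_of_hankelForm₂` — the `2 × 2` case IS the `RealLogConvexity` shape
  `g(k)² ≤ g(k−h)·g(k+h)` for `0 < h`, `1 ≤ k − h`: Hankel nodes `(k∓h+1)/2`, and THE ANCHOR `1 ≤ k − h` IS
  EXACTLY THE CONDITION THAT BOTH NODES LIE IN `[1,∞)` — the same anchor that §1 of `FarEdgeDescentAnchorLaw`
  proves cannot be relaxed (`realLogConvexity_false_without_anchor`).
* `realLogConvexity_of_laplace`, `anchoredLogConvexity_of_laplace`, `anchoredLaw_of_laplace` — the Laplace
  law of the excess implies 28902, the crux 28900, and every `L(a)`, `a ≥ 1`; with the special leaf it closes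
  the summit through the route's `closes` (`mm_of_finiteSaturation_of_laplace`); it is NECESSARY
  (`laplace_of_mm`, `ν = 0`).
* `expWorld_eq_laplace_dirac` — the separating EXPONENTIAL WORLD of the lineage (`e = w·e^{−λ(x−1)}`,
  lawful by `farTail_realisable`, `ω_W > 2`) is the Laplace law of the point mass `w·δ_λ`; hence it satisfies
  every Hankel/`L(a)` law (`expWorld_logConvexShape`).  So, exactly like the generic leaf it unifies, the Laplace
  law does NOT upgrade the cut: paired with anything weaker than the special leaf's contact strength it fails in
  a lawful world (tree `FarEdgeDescentExpFloor`, cut B `RealLogConvexity ∧ SuperExpContact`).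

HONEST TAGS.  Laplace law for `ω(1,·,1) − (·+1)`: NEC (trivially, `ν = 0`) · UNDECIDED · IDEA-NEEDED — no
tensor mechanism (Schönhage τ, laser, group-theoretic) is known to produce ANY Hankel minor of the excess; the
known 3D laws (Lotti–Romani convexity, Huang–Pan sandwich, monotonicity) are all ORDER-ONE (linear) in `e`,
the minors are quadratic.  This module is a READING of the generic leaf (where a mechanism would have to
live: positivity of a kernel, i.e. a sum-of-squares / Gram identity for `⟨n,n^x,n⟩`), not a new cut.
[cite: Widder1941, Ch. IV §§12–13, Thm. IV.12a (Bernstein), Thm. IV.21] [cite: LottiRomani1983, §2]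
[cite: HuangPan1998, §2 (2.5)–(2.8)] [cite: CoppersmithWinograd1990, §§6–8]
-/

set_option linter.dupNamespace false

noncomputable section

namespace Summit.MatrixMultiplication.MatrixMultiplication.Theorems.FarEdgeDescentLaplaceLaw

open Literature.Computability.AlgebraicComplexity Set MeasureTheory
open scoped NNReal ENNReal
open Summit.MatrixMultiplication.MatrixMultiplication.Theses.FarEdgeDescent
open Summit.MatrixMultiplication.MatrixMultiplication.Theorems.FarEdgeDescentChord
open Summit.MatrixMultiplication.MatrixMultiplication.Theorems.FarEdgeDescentAnchorLaw

/-! ## §1 Abstract: a Laplace transform of a positive measure is exponentially convex -/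

/-- Under a Laplace law the kernels `u ↦ exp(−u(y−1))`, `y ≥ 1`, are `ν`-a.e. bounded by `1`, hence integrable. -/
theorem integrable_laplaceKernel (ν : Measure ℝ) [IsFiniteMeasure ν] (hν : ν (Iio 0) = 0) {y : ℝ}
    (hy : 1 ≤ y) : Integrable (fun u : ℝ => Real.exp (-(u * (y - 1)))) ν := by
  have hae : ∀ᵐ u ∂ν, (0 : ℝ) ≤ u := by
    filter_upwards [measure_eq_zero_iff_ae_notMem.1 hν] with u hu
    simpa using hu
  refine Integrable.of_bound (Continuous.aestronglyMeasurable (by fun_prop)) 1 ?_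
  filter_upwards [hae] with u hu
  rw [Real.norm_eq_abs, abs_of_pos (Real.exp_pos _), Real.exp_le_one_iff]
  nlinarith

/-- **Exponential convexity from a Laplace law** (abstract).  If `g(x) = ∫ exp(−u(x−1)) dν(u)` for `x ≥ 1`,
`ν` finite and carried by `[0,∞)`, then every Hankel quadratic form of `g` on nodes `xᵢ ≥ 1` is nonnegative:
`0 ≤ ∑ᵢ ∑ⱼ cᵢ cⱼ g(xᵢ + xⱼ − 1)` — it equals `∫ (∑ᵢ cᵢ e^{−u(xᵢ−1)})² dν(u)`.
[cite: Widder1941, Ch. IV Thm. 21] -/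
theorem hankelForm_nonneg_of_laplace {g : ℝ → ℝ} (ν : Measure ℝ) [IsFiniteMeasure ν] (hν : ν (Iio 0) = 0)
    (hg : ∀ x : ℝ, 1 ≤ x → g x = ∫ u, Real.exp (-(u * (x - 1))) ∂ν)
    {n : ℕ} (x c : Fin n → ℝ) (hx : ∀ i, 1 ≤ x i) :
    0 ≤ ∑ i, ∑ j, c i * c j * g (x i + x j - 1) := by
  set φ : Fin n → ℝ → ℝ := fun i u => Real.exp (-(u * (x i - 1))) with hφ_def
  have hφφ : ∀ i j (u : ℝ), φ i u * φ j u = Real.exp (-(u * ((x i + x j - 1) - 1))) := fun i j u => by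
    simp only [hφ_def]
    rw [← Real.exp_add]
    congr 1; ring
  have hint2 : ∀ i j, Integrable (fun u => c i * c j * (φ i u * φ j u)) ν := fun i j => by
    simp_rw [hφφ]
    exact (integrable_laplaceKernel ν hν (by linarith [hx i, hx j])).const_mul _
  have hentry : ∀ i j, c i * c j * g (x i + x j - 1) = ∫ u, c i * c j * (φ i u * φ j u) ∂ν := fun i j => by
    rw [integral_const_mul, hg _ (by linarith [hx i, hx j])]
    simp_rw [hφφ]
  calc (0 : ℝ) ≤ ∫ u, (∑ i, c i * φ i u) ^ 2 ∂ν := integral_nonneg fun u => sq_nonneg _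
    _ = ∫ u, ∑ i, ∑ j, c i * c j * (φ i u * φ j u) ∂ν := by
        congr 1; ext u
        rw [sq, Finset.sum_mul_sum]
        exact Finset.sum_congr rfl fun i _ => Finset.sum_congr rfl fun j _ => by ring
    _ = ∑ i, ∫ u, ∑ j, c i * c j * (φ i u * φ j u) ∂ν :=
        integral_finsetSum _ fun i _ => integrable_finsetSum _ fun j _ => hint2 i j
    _ = ∑ i, ∑ j, ∫ u, c i * c j * (φ i u * φ j u) ∂ν :=
        Finset.sum_congr rfl fun i _ => integral_finsetSum _ fun j _ => hint2 i j
    _ = ∑ i, ∑ j, c i * c j * g (x i + x j - 1) := by simp_rw [hentry]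

/-- The discriminant step: a nonnegative binary quadratic form `u²A + 2uvB + v²C` with `A, C ≥ 0` has
`B² ≤ AC`. -/
theorem sq_le_mul_of_binaryForm_nonneg {A B C : ℝ} (hA : 0 ≤ A) (hC : 0 ≤ C)
    (hQ : ∀ u v : ℝ, 0 ≤ u * u * A + u * v * B + (v * u * B + v * v * C)) : B ^ 2 ≤ A * C := by
  rcases hA.lt_or_eq with hA' | hA'
  · have h := hQ B (-A)
    have e : B * B * A + B * -A * B + (-A * B * B + -A * -A * C) = A * (A * C - B ^ 2) := by ring
    rw [e] at h
    by_contra hlt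
    have : A * (A * C - B ^ 2) < 0 := mul_neg_of_pos_of_neg hA' (by linarith)
    linarith
  · subst hA'
    have hB : B = 0 := by
      by_contra hB
      have h := hQ (-(C + 1) / (2 * B)) 1
      have e : -(C + 1) / (2 * B) * 1 * B + 1 * (-(C + 1) / (2 * B)) * B = -(C + 1) := by
        field_simp; ring
      have e' : -(C + 1) / (2 * B) * (-(C + 1) / (2 * B)) * 0 = 0 := mul_zero _
      rw [e', zero_add, ← add_assoc, e] at h
      linarith
    subst hB
    simp

/-- **The `2 × 2` Hankel minor is the `RealLogConvexity` shape — and the anchor is the node condition.**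
From nonnegativity of the two-node Hankel forms of `g` (nodes in `[1,∞)`) and `g ≥ 0` on `[1,∞)`:
`g(k)² ≤ g(k−h)·g(k+h)` whenever `0 < h` and `1 ≤ k − h`; the nodes used are `(k−h+1)/2, (k+h+1)/2`, which
lie in `[1,∞)` EXACTLY because `k − h ≥ 1`. -/
theorem logConvexShape_of_hankelForm₂ {g : ℝ → ℝ} (hg0 : ∀ x : ℝ, 1 ≤ x → 0 ≤ g x)
    (h2 : ∀ (x c : Fin 2 → ℝ), (∀ i, 1 ≤ x i) → 0 ≤ ∑ i, ∑ j, c i * c j * g (x i + x j - 1)) :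
    ∀ k h : ℝ, 0 < h → 1 ≤ k - h → g k ^ 2 ≤ g (k - h) * g (k + h) := by
  intro k h hh hkh
  apply sq_le_mul_of_binaryForm_nonneg (hg0 _ hkh) (hg0 _ (by linarith))
  intro u v
  have H := h2 ![(k - h + 1) / 2, (k + h + 1) / 2] ![u, v] (by
    intro i
    fin_cases i
    · simp; linarith
    · simp; linarith)
  rw [Fin.sum_univ_two, Fin.sum_univ_two, Fin.sum_univ_two] at H
  simp only [Matrix.cons_val_zero, Matrix.cons_val_one] at H
  have e1 : (k - h + 1) / 2 + (k - h + 1) / 2 - 1 = k - h := by ring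
  have e2 : (k - h + 1) / 2 + (k + h + 1) / 2 - 1 = k := by ring
  have e3 : (k + h + 1) / 2 + (k - h + 1) / 2 - 1 = k := by ring
  have e4 : (k + h + 1) / 2 + (k + h + 1) / 2 - 1 = k + h := by ring
  rw [e1, e2, e3, e4] at H
  linarith

/-- **Laplace law ⟹ log-convex shape** (abstract `g`). -/
theorem logConvexShape_of_laplace {g : ℝ → ℝ} (ν : Measure ℝ) [IsFiniteMeasure ν] (hν : ν (Iio 0) = 0)
    (hg : ∀ x : ℝ, 1 ≤ x → g x = ∫ u, Real.exp (-(u * (x - 1))) ∂ν) :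
    ∀ k h : ℝ, 0 < h → 1 ≤ k - h → g k ^ 2 ≤ g (k - h) * g (k + h) :=
  logConvexShape_of_hankelForm₂
    (fun y hy => by rw [hg y hy]; exact integral_nonneg fun u => (Real.exp_pos _).le)
    (fun x c hx => hankelForm_nonneg_of_laplace ν hν hg x c hx)

/-! ## §2 The excess: the Laplace law implies the generic leaf, all `L(a)` (`a ≥ 1`), all Hankel orders -/

/-- **Laplace law of the excess ⟹ `RealLogConvexity`** (aside 28902). -/
theorem realLogConvexity_of_laplace (ν : Measure ℝ) [IsFiniteMeasure ν] (hν : ν (Iio 0) = 0)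
    (he : ∀ x : ℝ, 1 ≤ x → omegaRect ℂ 1 x 1 - (x + 1) = ∫ u, Real.exp (-(u * (x - 1))) ∂ν) :
    RealLogConvexity := by
  intro k h hh hkh
  exact logConvexShape_of_laplace (g := fun x => omegaRect ℂ 1 x 1 - (x + 1)) ν hν he k h hh hkh

/-- **Laplace law of the excess ⟹ the generic crux `AnchoredLogConvexity`** (28900). -/
theorem anchoredLogConvexity_of_laplace (ν : Measure ℝ) [IsFiniteMeasure ν] (hν : ν (Iio 0) = 0)
    (he : ∀ x : ℝ, 1 ≤ x → omegaRect ℂ 1 x 1 - (x + 1) = ∫ u, Real.exp (-(u * (x - 1))) ∂ν) :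
    AnchoredLogConvexity :=
  anchoredLaw_one_iff.mp (anchoredLaw_of_realLogConvexity le_rfl (realLogConvexity_of_laplace ν hν he))

/-- **Laplace law of the excess ⟹ every far-anchored law `L(a)`, `a ≥ 1`** (and, by §2 of
`FarEdgeDescentAnchorLaw`, no law with `a < 1` can follow from anything consistent with the special leaf). -/
theorem anchoredLaw_of_laplace (ν : Measure ℝ) [IsFiniteMeasure ν] (hν : ν (Iio 0) = 0)
    (he : ∀ x : ℝ, 1 ≤ x → omegaRect ℂ 1 x 1 - (x + 1) = ∫ u, Real.exp (-(u * (x - 1))) ∂ν)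
    {a : ℝ} (ha : 1 ≤ a) :
    ∀ m : ℝ, a < m → (omegaRect ℂ 1 m 1 - (m + 1)) ^ 2 ≤
        (omegaRect ℂ 1 a 1 - (a + 1)) * (omegaRect ℂ 1 (2 * m - a) 1 - (2 * m - a + 1)) :=
  anchoredLaw_of_realLogConvexity ha (realLogConvexity_of_laplace ν hν he)

/-- **All Hankel orders**: under the Laplace law every form `∑ᵢⱼ cᵢcⱼ e(xᵢ+xⱼ−1)`, `xᵢ ≥ 1`, is `≥ 0`
(the order-`n` laws; order 2 = the generic leaf's family, orders ≥ 3 are statements the lineage never had). -/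
theorem hankelForm_excess_nonneg_of_laplace (ν : Measure ℝ) [IsFiniteMeasure ν] (hν : ν (Iio 0) = 0)
    (he : ∀ x : ℝ, 1 ≤ x → omegaRect ℂ 1 x 1 - (x + 1) = ∫ u, Real.exp (-(u * (x - 1))) ∂ν)
    {n : ℕ} (x c : Fin n → ℝ) (hx : ∀ i, 1 ≤ x i) :
    0 ≤ ∑ i, ∑ j, c i * c j * (omegaRect ℂ 1 (x i + x j - 1) 1 - (x i + x j - 1 + 1)) :=
  hankelForm_nonneg_of_laplace (g := fun x => omegaRect ℂ 1 x 1 - (x + 1)) ν hν he x c hx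

/-- **Necessity**: under `ω = 2` the excess vanishes on `[1,∞)` — the Laplace law of the ZERO measure. -/
theorem laplace_of_mm (hS : _root_.MatrixMultiplication) :
    ∃ ν : Measure ℝ, IsFiniteMeasure ν ∧ ν (Iio 0) = 0 ∧
      ∀ x : ℝ, 1 ≤ x → omegaRect ℂ 1 x 1 - (x + 1) = ∫ u, Real.exp (-(u * (x - 1))) ∂ν := by
  refine ⟨0, inferInstance, by simp, fun x hx => ?_⟩
  rw [_root_.MatrixMultiplication_iff] at hS
  rw [integral_zero_measure, saturated_of_omega_eq_two hS hx]
  ring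

/-- **With the special leaf the Laplace law closes the summit — through the crux, by the route's `closes`.** -/
theorem mm_of_finiteSaturation_of_laplace (hF : FiniteSaturation) (ν : Measure ℝ) [IsFiniteMeasure ν]
    (hν : ν (Iio 0) = 0)
    (he : ∀ x : ℝ, 1 ≤ x → omegaRect ℂ 1 x 1 - (x + 1) = ∫ u, Real.exp (-(u * (x - 1))) ∂ν) :
    _root_.MatrixMultiplication :=
  closes hF (anchoredLogConvexity_of_laplace ν hν he)

/-! ## §3 The separating exponential world is a Laplace law (point mass) -/

/-- The exponential profile `w·exp(−λ(x−1))` is the Laplace law of the point mass `w·δ_λ`. -/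
theorem expWorld_eq_laplace_dirac (w : ℝ≥0) (l x : ℝ) :
    (w : ℝ) * Real.exp (-(l * (x - 1))) = ∫ u, Real.exp (-(u * (x - 1))) ∂(w • Measure.dirac l) := by
  rw [integral_smul_nnreal_measure, integral_dirac]
  rfl

/-- The point mass `w·δ_λ`, `λ ≥ 0`, is carried by `[0,∞)`. -/
theorem dirac_smul_Iio_zero (w : ℝ≥0) {l : ℝ} (hl : 0 ≤ l) : (w • Measure.dirac l) (Iio (0 : ℝ)) = 0 := by
  rw [Measure.smul_apply, Measure.dirac_apply' _ measurableSet_Iio, Set.indicator_of_notMem (by simpa using hl)]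
  simp

/-- Hence **the exponential world satisfies every Hankel / anchored law** — in particular the
`RealLogConvexity` shape — although its `ω_W = 2 + w > 2` (tree `FarEdgeDescentExpFloor`): the Laplace law,
like the generic leaf it unifies, does not by itself decide the summit. -/
theorem expWorld_logConvexShape (w : ℝ≥0) {l : ℝ} (hl : 0 ≤ l) :
    ∀ k h : ℝ, 0 < h → 1 ≤ k - h →
      ((w : ℝ) * Real.exp (-(l * (k - 1)))) ^ 2 ≤
        ((w : ℝ) * Real.exp (-(l * (k - h - 1)))) * ((w : ℝ) * Real.exp (-(l * (k + h - 1)))) :=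
  logConvexShape_of_laplace (g := fun x => (w : ℝ) * Real.exp (-(l * (x - 1)))) (w • Measure.dirac l)
    (dirac_smul_Iio_zero w hl) (fun x _ => expWorld_eq_laplace_dirac w l x)

end Summit.MatrixMultiplication.MatrixMultiplication.Theorems.FarEdgeDescentLaplaceLaw

end
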